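import Summits.Ventures.PercRepro.C025ProfilePLDSolidLiftNine
import Summits.Ventures.PercRepro.C025ProfilePLDSixLiftFiveCorollaries

/-!
# SOLIDS AT RANK ≤ 9 (BASE 8): (PLD)-MATROIDS OF RANK ≤ 9 ⊕ A SOLID WITH ≥ 8 POINTS, «RANK ≤ 3 ⊕ U_{6,m′} ⊕ SOLID» (night-3 g34)

`proofs/NIGHT3-G34-FASTLIFT.md` §3.  With `PLDSolidLift.pld_disjointSum_uniform_four_ge_8_of_eRank_le_9` — (PLD)(M) ∧ rank M ≤ 9
⟹ (PLD)(M ⊕ U_{4,m}) for every `m ≥ 8` (base 8: the rank-9 second preserver is q₄′ = T₂₄ + 4·T₃₄ and the base-7 identity would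
need a negative amount of T₃₄ at m = 8, 9) — and the landed rank-3 base for the rank-6 uniform summand (g33): (PLD), hence C-025 at
every `(p, q)` on every truncation of `N ⊕ free points`, for `N` = «any (PLD)-matroid of rank ≤ 9 ⊕ a solid with ≥ 8 points» and
«any matroid of rank ≤ 3 ⊕ U_{6,m′} with m′ ≥ 11 ⊕ such a solid» (rank exactly 9 before the lift).  No `def`, no `instance`, no
notation.  Axioms: standard.
-/

open scoped Matroid

namespace PercRepro

open Finset ThmH

namespace PLDSolidLift

variable {α : Type} [DecidableEq α]

/-- C-025 AT EVERY `(p, q)` ON EVERY TRUNCATION OF «(PLD)-MATROID OF RANK ≤ 9 ⊕ A SOLID WITH ≥ 8 POINTS ⊕ FREE POINTS». -/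
theorem rls_truncate_disjointSum_solid_freeOn_of_pld_nine (M : Matroid α) [M.Finite] (hr : M.eRank ≤ 9)
    (hPLD : ∀ lo hi δ Θ : ℕ, Θ ≤ lo + hi + δ → (lo = 0 ∨ lo + hi + δ ≤ Θ) →
      (∑ I ∈ (gr M).powerset, (if lo ≤ (M.eRk (I : Set α)).toNat ∧ (M.eRk (I : Set α)).toNat ≤ hi ∧
          Θ ≤ (M.eRk ((gr M \ I : Finset α) : Set α)).toNat + (M.eRk (I : Set α)).toNat then
          ((M.eRk ((gr M \ I : Finset α) : Set α)).toNat).choose δ else 0)) ≤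
        ∑ I ∈ (gr M).powerset, (if lo + δ ≤ (M.eRk ((gr M \ I : Finset α) : Set α)).toNat ∧
          (M.eRk ((gr M \ I : Finset α) : Set α)).toNat ≤ hi + δ then
          ((M.eRk ((gr M \ I : Finset α) : Set α)).toNat).choose δ else 0))
    (F : Finset α) (hF : 8 ≤ F.card) (h : Disjoint M.E (@Matroid.truncate α (Matroid.freeOn (F : Set α)) (PLDTruncate.freeOn_finite' F) 4).E)
    (E₃ : Finset α) (h₃ : Disjoint (M.disjointSum (@Matroid.truncate α (Matroid.freeOn (F : Set α)) (PLDTruncate.freeOn_finite' F) 4) h).E (E₃ : Set α)) (r p q : ℕ) :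
    haveI := PLDTruncate.freeOn_finite' F
    haveI := PLDClosure.disjointSum_finite' _ _ h
    haveI := PLDBridge.disjointSum_freeOn_finite _ E₃ h₃
    ThmN.RLS (PercRepro.Matroid.truncate ((M.disjointSum (@Matroid.truncate α (Matroid.freeOn (F : Set α)) (PLDTruncate.freeOn_finite' F) 4) h).disjointSum (Matroid.freeOn (E₃ : Set α)) h₃) r) p q := by
  haveI := PLDTruncate.freeOn_finite' F
  haveI := PLDClosure.disjointSum_finite' _ _ h
  exact PLDBridge.rls_disjointSum_freeOn_of_pld _ E₃ h₃ r p q (pld_disjointSum_uniform_four_ge_8_of_eRank_le_9 M hr hPLD F hF h)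

/-- (PLD) FOR «RANK ≤ 3 ⊕ U_{6,m′} WITH m′ ≥ 11 ⊕ A SOLID WITH ≥ 8 POINTS» (unconditional; the rank-6 summand first, then the solid at rank ≤ 9). -/
theorem pld_disjointSum_six_solid_of_eRank_le_three (M : Matroid α) [M.Finite] (h3 : M.eRank ≤ 3)
    (F₁ : Finset α) (hF₁ : 11 ≤ F₁.card) (h₁ : Disjoint M.E (@Matroid.truncate α (Matroid.freeOn (F₁ : Set α)) (PLDTruncate.freeOn_finite' F₁) 6).E)
    (F₂ : Finset α) (hF₂ : 8 ≤ F₂.card)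
    (h₂ : Disjoint (M.disjointSum (@Matroid.truncate α (Matroid.freeOn (F₁ : Set α)) (PLDTruncate.freeOn_finite' F₁) 6) h₁).E (@Matroid.truncate α (Matroid.freeOn (F₂ : Set α)) (PLDTruncate.freeOn_finite' F₂) 4).E) :
    haveI := PLDTruncate.freeOn_finite' F₁
    haveI := PLDTruncate.freeOn_finite' F₂
    haveI := PLDClosure.disjointSum_finite' _ _ h₁
    haveI := PLDClosure.disjointSum_finite' _ _ h₂
    ∀ lo hi δ Θ : ℕ, Θ ≤ lo + hi + δ → (lo = 0 ∨ lo + hi + δ ≤ Θ) →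
      (∑ I ∈ (gr ((M.disjointSum (@Matroid.truncate α (Matroid.freeOn (F₁ : Set α)) (PLDTruncate.freeOn_finite' F₁) 6) h₁).disjointSum (@Matroid.truncate α (Matroid.freeOn (F₂ : Set α)) (PLDTruncate.freeOn_finite' F₂) 4) h₂)).powerset, (if lo ≤ (((M.disjointSum (@Matroid.truncate α (Matroid.freeOn (F₁ : Set α)) (PLDTruncate.freeOn_finite' F₁) 6) h₁).disjointSum (@Matroid.truncate α (Matroid.freeOn (F₂ : Set α)) (PLDTruncate.freeOn_finite' F₂) 4) h₂).eRk (I : Set α)).toNat ∧ (((M.disjointSum (@Matroid.truncate α (Matroid.freeOn (F₁ : Set α)) (PLDTruncate.freeOn_finite' F₁) 6) h₁).disjointSum (@Matroid.truncate α (Matroid.freeOn (F₂ : Set α)) (PLDTruncate.freeOn_finite' F₂) 4) h₂).eRk (I : Set α)).toNat ≤ hi ∧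
          Θ ≤ (((M.disjointSum (@Matroid.truncate α (Matroid.freeOn (F₁ : Set α)) (PLDTruncate.freeOn_finite' F₁) 6) h₁).disjointSum (@Matroid.truncate α (Matroid.freeOn (F₂ : Set α)) (PLDTruncate.freeOn_finite' F₂) 4) h₂).eRk ((gr ((M.disjointSum (@Matroid.truncate α (Matroid.freeOn (F₁ : Set α)) (PLDTruncate.freeOn_finite' F₁) 6) h₁).disjointSum (@Matroid.truncate α (Matroid.freeOn (F₂ : Set α)) (PLDTruncate.freeOn_finite' F₂) 4) h₂) \ I : Finset α) : Set α)).toNat + (((M.disjointSum (@Matroid.truncate α (Matroid.freeOn (F₁ : Set α)) (PLDTruncate.freeOn_finite' F₁) 6) h₁).disjointSum (@Matroid.truncate α (Matroid.freeOn (F₂ : Set α)) (PLDTruncate.freeOn_finite' F₂) 4) h₂).eRk (I : Set α)).toNat then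
          ((((M.disjointSum (@Matroid.truncate α (Matroid.freeOn (F₁ : Set α)) (PLDTruncate.freeOn_finite' F₁) 6) h₁).disjointSum (@Matroid.truncate α (Matroid.freeOn (F₂ : Set α)) (PLDTruncate.freeOn_finite' F₂) 4) h₂).eRk ((gr ((M.disjointSum (@Matroid.truncate α (Matroid.freeOn (F₁ : Set α)) (PLDTruncate.freeOn_finite' F₁) 6) h₁).disjointSum (@Matroid.truncate α (Matroid.freeOn (F₂ : Set α)) (PLDTruncate.freeOn_finite' F₂) 4) h₂) \ I : Finset α) : Set α)).toNat).choose δ else 0)) ≤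
        ∑ I ∈ (gr ((M.disjointSum (@Matroid.truncate α (Matroid.freeOn (F₁ : Set α)) (PLDTruncate.freeOn_finite' F₁) 6) h₁).disjointSum (@Matroid.truncate α (Matroid.freeOn (F₂ : Set α)) (PLDTruncate.freeOn_finite' F₂) 4) h₂)).powerset, (if lo + δ ≤ (((M.disjointSum (@Matroid.truncate α (Matroid.freeOn (F₁ : Set α)) (PLDTruncate.freeOn_finite' F₁) 6) h₁).disjointSum (@Matroid.truncate α (Matroid.freeOn (F₂ : Set α)) (PLDTruncate.freeOn_finite' F₂) 4) h₂).eRk ((gr ((M.disjointSum (@Matroid.truncate α (Matroid.freeOn (F₁ : Set α)) (PLDTruncate.freeOn_finite' F₁) 6) h₁).disjointSum (@Matroid.truncate α (Matroid.freeOn (F₂ : Set α)) (PLDTruncate.freeOn_finite' F₂) 4) h₂) \ I : Finset α) : Set α)).toNat ∧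
          (((M.disjointSum (@Matroid.truncate α (Matroid.freeOn (F₁ : Set α)) (PLDTruncate.freeOn_finite' F₁) 6) h₁).disjointSum (@Matroid.truncate α (Matroid.freeOn (F₂ : Set α)) (PLDTruncate.freeOn_finite' F₂) 4) h₂).eRk ((gr ((M.disjointSum (@Matroid.truncate α (Matroid.freeOn (F₁ : Set α)) (PLDTruncate.freeOn_finite' F₁) 6) h₁).disjointSum (@Matroid.truncate α (Matroid.freeOn (F₂ : Set α)) (PLDTruncate.freeOn_finite' F₂) 4) h₂) \ I : Finset α) : Set α)).toNat ≤ hi + δ then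
          ((((M.disjointSum (@Matroid.truncate α (Matroid.freeOn (F₁ : Set α)) (PLDTruncate.freeOn_finite' F₁) 6) h₁).disjointSum (@Matroid.truncate α (Matroid.freeOn (F₂ : Set α)) (PLDTruncate.freeOn_finite' F₂) 4) h₂).eRk ((gr ((M.disjointSum (@Matroid.truncate α (Matroid.freeOn (F₁ : Set α)) (PLDTruncate.freeOn_finite' F₁) 6) h₁).disjointSum (@Matroid.truncate α (Matroid.freeOn (F₂ : Set α)) (PLDTruncate.freeOn_finite' F₂) 4) h₂) \ I : Finset α) : Set α)).toNat).choose δ else 0) := by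
  haveI := PLDTruncate.freeOn_finite' F₁
  haveI := PLDTruncate.freeOn_finite' F₂
  haveI := PLDClosure.disjointSum_finite' _ _ h₁
  have h1 := PLDSixLift.pld_disjointSum_six_of_eRank_le_three M h3 F₁ hF₁ h₁
  have hr1 : (M.disjointSum (@Matroid.truncate α (Matroid.freeOn (F₁ : Set α)) (PLDTruncate.freeOn_finite' F₁) 6) h₁).eRank ≤ 9 := by
    rw [PLDTwoLiftGen.eRank_disjointSum]
    calc M.eRank + (@Matroid.truncate α (Matroid.freeOn (F₁ : Set α)) (PLDTruncate.freeOn_finite' F₁) 6).eRank ≤ 3 + 6 := add_le_add h3 (PLDSixLift.eRank_six_le F₁)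
      _ ≤ 9 := by norm_num
  exact pld_disjointSum_uniform_four_ge_8_of_eRank_le_9 _ hr1 h1 F₂ hF₂ h₂

/-- C-025 AT EVERY `(p, q)` ON EVERY TRUNCATION OF «RANK ≤ 3 ⊕ U_{6,m′} WITH m′ ≥ 11 ⊕ A SOLID WITH ≥ 8 POINTS ⊕ FREE POINTS». -/
theorem rls_truncate_disjointSum_six_solid_freeOn_of_eRank_le_three (M : Matroid α) [M.Finite] (h3 : M.eRank ≤ 3)
    (F₁ : Finset α) (hF₁ : 11 ≤ F₁.card) (h₁ : Disjoint M.E (@Matroid.truncate α (Matroid.freeOn (F₁ : Set α)) (PLDTruncate.freeOn_finite' F₁) 6).E)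
    (F₂ : Finset α) (hF₂ : 8 ≤ F₂.card)
    (h₂ : Disjoint (M.disjointSum (@Matroid.truncate α (Matroid.freeOn (F₁ : Set α)) (PLDTruncate.freeOn_finite' F₁) 6) h₁).E (@Matroid.truncate α (Matroid.freeOn (F₂ : Set α)) (PLDTruncate.freeOn_finite' F₂) 4).E)
    (E₃ : Finset α) (h₃ : Disjoint ((M.disjointSum (@Matroid.truncate α (Matroid.freeOn (F₁ : Set α)) (PLDTruncate.freeOn_finite' F₁) 6) h₁).disjointSum (@Matroid.truncate α (Matroid.freeOn (F₂ : Set α)) (PLDTruncate.freeOn_finite' F₂) 4) h₂).E (E₃ : Set α)) (r p q : ℕ) :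
    haveI := PLDTruncate.freeOn_finite' F₁
    haveI := PLDTruncate.freeOn_finite' F₂
    haveI := PLDClosure.disjointSum_finite' _ _ h₁
    haveI := PLDClosure.disjointSum_finite' _ _ h₂
    haveI := PLDBridge.disjointSum_freeOn_finite _ E₃ h₃
    ThmN.RLS (PercRepro.Matroid.truncate (((M.disjointSum (@Matroid.truncate α (Matroid.freeOn (F₁ : Set α)) (PLDTruncate.freeOn_finite' F₁) 6) h₁).disjointSum (@Matroid.truncate α (Matroid.freeOn (F₂ : Set α)) (PLDTruncate.freeOn_finite' F₂) 4) h₂).disjointSum (Matroid.freeOn (E₃ : Set α)) h₃) r) p q := by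
  haveI := PLDTruncate.freeOn_finite' F₁
  haveI := PLDTruncate.freeOn_finite' F₂
  haveI := PLDClosure.disjointSum_finite' _ _ h₁
  haveI := PLDClosure.disjointSum_finite' _ _ h₂
  exact PLDBridge.rls_disjointSum_freeOn_of_pld _ E₃ h₃ r p q
    (pld_disjointSum_six_solid_of_eRank_le_three M h3 F₁ hF₁ h₁ F₂ hF₂ h₂)
end PLDSolidLift

end PercRepro
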